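import Literature.MathematicalPhysics.QuantumFieldTheory.Balaban1983to89.T4AveragingDeficitNonAbelian


/-!
# AveragingDeficitTransport (T⁴ programme, node NE3, row NE3-R2) — the linearised parallel transport `(δ_ψV)(Γ)` of B7 (9) along the perturbation
# `V e^{sψ}`, its skew-adjointness, LOCALITY of (9)/(42)/(44) in the perturbation, the near-identity comparison with
# the abelian contour functional `ψ(Γ)`, gauge covariance of the dressed curl, and the consumer tools (covariant
# telescoping, the Wilson-weight pairing against the flux) — layer 1 of the proof programme for the derivative wall β

HONEST FRAMING (cell `pub-balaban`, T4-DAG PAGE 1; unit `b2b-balaban-t4-ne3r2-p1` = owner of BINDER-OWNERS row NE3-R2,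
session 1; successor of the retired lineage `b2b-balaban-t4-ne3-p2` whose gen-8 draft §0–§1 is §0–§1 here).  The cell's
T4 target is the finite-torus continuum limit of the unit-scale averaged loop expectations — NOT infinite volume, NO
mass gap, NOT the Clay problem, NOT summit progress.  NE3 (node U1 (b)) on the ENERGY ROUTE has exactly one open input,
the derivative wall β = `T4AveragingDeficitWall.DeficitDerivWall d N L C a₀ R` (GAPS G-ne3p2-1; the value walls β′-per /
β′-loc are theorems of `T4AveragingDeficitNonAbelian`, and `ClaimBetaPer ⟺ β ⟺ ClaimBetaLoc`).  THIS FILE DOES NOT PROVE β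
and does not re-type, weaken or assert it.  It supplies the first layer of the programme
  β ⇐ (W) Wilson-weight pairing ∧ (DL) derivative-level linearisation of the average (42) ∧ (M) main bilinear term,
namely the calculus of the LINEARISED TRANSPORT: for `V_s = V e^{sψ}` (`T4AveragingDeficitWall.vary`) and any lattice
word `Γ`, `d/ds|₀ V_s(Γ) = (δ_ψV)(Γ) · V(Γ)` with `(δ_ψV)(Γ) = Σ_{letters} Ad_{V(prefix)} (±ψ(b))` (`dhol`; B7 p. 28:
«the product over `b` replaced by the sum», dressed by `R(X)Y = XYX⁻¹` of (56)).  NE3 stays COND-free (no BetaPertH /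
(B) / (B^μ)).

WHAT IS PROVED (all sorry-free; [folklore] matrix calculus / bookkeeping on the tree's OWN transcriptions `hol` (9),
`Wcx`/`Xavg`/`bavg` (42), `cplaq` (44), `gaugeAct` (11)/(45); the `[cite:]` tags name those printed formulas as CONTEXT).
THIS FILE (1/3): §0 `Ad` bookkeeping (`Ad_mul_val`, `norm_Ad_of_unitary`).  §1 `dstep`, `dhol` (+ `dhol_nil/cons`),
`hasDerivAt_val_stepHol_vary`, **`hasDerivAt_val_hol_vary_word : HasDerivAt (s ↦ V_s(Γ)) ((δ_ψV)(Γ)·V(Γ)) 0`** for EVERY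
word, `dhol_append` (multiplicativity `δ(Γ₁Γ₂) = δΓ₁ + Ad_{V(Γ₁)}δΓ₂`), `dhol_plaqWord` (on a plaquette word `δ` IS the
tree's dressed curl `curlAt`), `lnorm`, `norm_dhol_le` (`‖δ_ψV(Γ)‖ ≤ Σ_{b⊂Γ}‖ψ(b)‖` on `U(N)`).  §2 skew-adjointness on
`U(N)` data with `𝔲(N)` directions: `val_inv_eq_star_of_unitary`, `mem_U1_of_unitary`, `Ad_mem_skewAdjoint`,
`dhol_mem_skewAdjoint`, **`curl_mem_skewAdjoint`**, `nReTr_eq_zero_of_mem_skewAdjoint` (`Re tr` kills `𝔲(N)` — why flat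
configurations are critical), and **`mem_skewAdjoint_of_unitary_path`** (the log-derivative `f′f(0)⋆` of a path that is
unitary near `0` is skew — differentiate `ff⋆ = 1`; this is what makes `Re tr Ω_P = 0` for the derivative `Ω_P` of the
coarse plaquette variable).  FILE 2/3 `AveragingDeficitLocality`: LOCALITY (`bondsOf`, `hol_vary_eq_of_forall/of_l1`,
`Wcx_vary_eq_of_l1`, `bavg_vary_eq_of_l1`, `cplaq_bavg_vary_eq_of_l1`/`chol_vary_eq_of_l1` — radius `(2d+3)L` about the
fine corner —, `fhol_vary_eq_of_l1`, `curl_eq_zero_of_l1`: the finite dependence set behind `∀ᶠ W` of β) and GAUGE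
COVARIANCE (`dirGauge`, `gaugeAct_vary : (V e^{sψ})^u = V^u e^{sψ^u}`, `curl_gaugeAct : d_{V^u}ψ^u = Ad_u d_Vψ`).  FILE 3/3
`AveragingDeficitNearIdentity`: `norm_Ad_sub_le`, `norm_hol_sub_one_le_of_bonds`, **`norm_dhol_sub_asum_le(_of_l1)`**
(`‖(δ_ψV)(Γ) − ψ(Γ)‖ ≤ 2|Γ|β·Σ_{b⊂Γ}‖ψ(b)‖` when every bond of `Γ` is within `β` of `1`, `ψ(Γ) = B7Prop1Explicit.asum` —
the derivative-level analogue of `walk_linear`, for the axial gauge of p. 24 where `β = O(L·a)` by `axial_bond_bound`),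
and the consumer tools `Ad_add/…/sum`, `nReTr_Ad`, `abs_nReTr_mul_le`, **`abs_nReTr_mul_sub_mul_mlog_le`** (skew `G`,
`‖C − 1‖ ≤ 1/4`: `|Re tr(GC) − Re tr(G log C)| ≤ 4‖C − 1‖²‖G‖` — the fine-side Wilson-weight pairing of β up to its
`a²‖d_Vψ‖_{ℓ¹}` slot), **`norm_Ad_hol_sub_le_sum_covGrad`** (covariant telescoping against the tree's `covGrad` — the
mechanism of the main bilinear term (M)), `lnorm_le_length_mul_sum`, `sum_bondsOf_le_length_mul_sum`.

CITATION HEADER (lean-in-tree rule 2026-08-18; cited-only lint 2026-08-19).  No sentence of any paper is used as a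
hypothesis and the manuscripts under audit are not cited for any disputed step.  Every declaration is [folklore] matrix
calculus or lattice bookkeeping about the tree's own transcriptions of printed DEFINITIONS; the `[cite: …]` tags name
those formulas as CONTEXT: T. Bałaban, *Averaging operations for lattice gauge theories*, Commun. Math. Phys. **98**
(1985) 17–51 [Balaban1985Averaging] («B7»: (9) p. 18 parallel transport; (11) p. 19 and (45) p. 24 gauge covariance;
(19) p. 21 operator norm; (22)–(23) p. 21 `log U = iA`, `A` hermitian; (42) p. 23 the average; (44) p. 24 the
`L`-plaquette variable; (56) p. 27 `R(X)Y = XYX⁻¹`; p. 28 the linearised average `Q₀A`, «the product over `b` replaced by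
the sum»); T. Bałaban, Commun. Math. Phys. **102** (1985) 277–309 [Balaban1985Variational] («B11»: (5) p. 278 the Wilson
weight `1 − Re tr`).  Companions used BY NAME: `B7Prop1Explicit` (`hol`, `stepHol`, `disp`, `seg`, `gammaWord`, `Wcx`,
`Xavg`, `bavg`, `cplaq`, `gaugeAct`, `asum`, `stepA`, `l1`, `boxVec`, `U1`, `norm_inv_sub_one_le`, `stepHol_mem`,
`hol_gaugeAct_closed`, `disp_plaqWord`, `exp_units_conj` (Mathlib), `expUnit`, `norm_exp_sub_one_le_of_norm_le`,
`expRem_le_sq`), `B7Prop2Explicit` (`unitaryUnits`, `mem_unitaryUnits`), `MatrixLog` (`mlog`, `exp_mlog`,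
`norm_mlog_le_two_mul`), `MatrixNorms` (`abs_nReTr_le_opNorm`, `opNorm_mul_le`), `UnitaryModel` (`nReTr`, `nReTr_conj`),
`T4AveragingDeficitWall` (`vary`, `Ad`, `curlAt`, `curl`, `fhol`, `chol`, `covGrad`, `IsUnitaryCfg`, `IsSkewDir`,
`hasDerivAt_hol_vary`, `hasDerivAt_fhol_vary`, `vary_zero`, `vary_eq_of_eq_zero`, `nReTrL`, `hasDerivAt_exp_(neg_)smul_zero`),
`T4AveragingDeficitNonAbelian` (`Ad_mul`, `Ad_sub`), `B8Ineq170.norm_mul_sub_one_le_of_norm_le_one`; Mathlib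
(`HasDerivAt.mul/star/unique`, `CStarRing.norm_of_mem_unitary`, `Matrix.trace_conjTranspose`).

NOT CLAIMED.  β, (W) beyond the fine-side pairing, (DL), (M), anything about minimisers or NE3; the derivative of the
average (42) itself (next layer: `log`/`exp` Duhamel terms via `Literature.Analysis.Calculus.ExpDuhamel`).  PLACEMENT
(human rule 2026-08-19): new cell work lives under `Summits/QuantumFields/BalabanUV/`; this file imports the retired
lineage's Literature-homed leaves where they landed and moves nothing.  Record: HOME `t4/T4-EST-NE3-R2.md` (this unit),
predecessors `t4/T4-EST-NE3-P2.md` v1.33 §0 (e), Appendix β `t4/T4-EST-NE3-P2-beta.md` v0.19 (cell `pub-balaban`,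
HOME `run/shared/lean/pub/pub-balaban/`).
-/

set_option autoImplicit false

open scoped BigOperators Matrix Matrix.Norms.L2Operator Topology
open NormedSpace Finset Filter

namespace Summit.QuantumFields.BalabanUV.T4Continuum.AveragingDeficitTransport

open Literature.MathematicalPhysics.QuantumFieldTheory.Balaban1983to89

open B7Prop1Explicit B7Prop2Explicit MatrixLog UnitaryModel
open T4AveragingDeficitWall hiding Site Plane Plaq Bond
open T4AveragingDeficitNonAbelian (Ad_mul Ad_sub)

noncomputable section

variable {d : ℕ} {n : Type*} [Fintype n] [DecidableEq n]

local notation "𝕄" => Matrix n n ℂ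
local notation "Site" => B7Prop1Explicit.Site

/-! ## §0 `Ad` bookkeeping -/

/-- `Ad_u (X + Y) = Ad_u X + Ad_u Y`. [folklore] -/
private theorem Ad_add' (u : 𝕄ˣ) (X Y : 𝕄) : Ad u (X + Y) = Ad u X + Ad u Y := by
  unfold Ad
  rw [mul_add, add_mul]

/-- `Ad_1 X = X`. [folklore] -/
private theorem Ad_one' (X : 𝕄) : Ad (1 : 𝕄ˣ) X = X := by
  unfold Ad
  rw [inv_one, Units.val_one, one_mul, mul_one]

/-- `Ad_u X · u = u · X`. [folklore] -/
theorem Ad_mul_val (u : 𝕄ˣ) (X : 𝕄) : Ad u X * (u : 𝕄) = (u : 𝕄) * X := by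
  unfold Ad
  rw [Units.inv_mul_cancel_right]

/-- `Ad_u` is an isometry of the operator norm (19) for unitary `u`. [cite: Balaban1985Averaging, (19) p.21, (56) p.27] -/
theorem norm_Ad_of_unitary {u : 𝕄ˣ} (hu : u ∈ unitaryUnits 𝕄) (X : 𝕄) : ‖Ad u X‖ = ‖X‖ := by
  rcases isEmpty_or_nonempty n with hn | hn
  · have h1 : Ad u X = 0 := Subsingleton.elim _ _
    have h2 : X = 0 := Subsingleton.elim _ _
    rw [h1, h2]
  have hU : (u : 𝕄) ∈ unitary 𝕄 := mem_unitaryUnits.mp hu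
  have hUi : ((u⁻¹ : 𝕄ˣ) : 𝕄) ∈ unitary 𝕄 := mem_unitaryUnits.mp ((unitaryUnits 𝕄).inv_mem hu)
  unfold Ad
  rw [CStarRing.norm_mul_mem_unitary _ hUi, CStarRing.norm_mem_unitary_mul _ hU]

/-! ## §1 The linearised parallel transport `(δ_ψ V)(Γ)` along an arbitrary lattice word -/

/-- The contribution of one letter to the left-trivialised derivative of parallel transport along `V e^{sψ}`:
`Ad_{V(b)} ψ(b)` for a positively traversed bond `b = ⟨x, x + e_μ⟩` (`d/ds V e^{sψ} = Ad_V ψ · V`), `−ψ(b)` for a negatively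
traversed one (`d/ds (V e^{sψ})⁻¹ = −ψ · V⁻¹`). [folklore] -/
def dstep (V : Site d → Fin d → 𝕄ˣ) (ψ : Site d → Fin d → 𝕄) (x : Site d) (l : Letter d) : 𝕄 :=
  if l.2 then Ad (V x l.1) (ψ x l.1) else -ψ (x + l.vec) l.1

/-- **THE LINEARISED PARALLEL TRANSPORT** `(δ_ψ V)(Γ)` of (9) along the word `Γ` spelled from `x`, left-trivialised:
`δ(l·Γ) = δl + Ad_{V(l)} δΓ` — B7 p. 28's `R_{0,·}`-dressed sums «the product over `b` replaced by the sum», here for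
the perturbation `V e^{sψ}` (`hasDerivAt_val_hol_vary_word`). [cite: Balaban1985Averaging, (9) p.18, (56) p.27, p.28] -/
def dhol (V : Site d → Fin d → 𝕄ˣ) (ψ : Site d → Fin d → 𝕄) : Site d → List (Letter d) → 𝕄
  | _, [] => 0
  | x, l :: w => dstep V ψ x l + Ad (stepHol V x l) (dhol V ψ (x + l.vec) w)

/-- `δ(∅) = 0`. [folklore] -/
@[simp] theorem dhol_nil (V : Site d → Fin d → 𝕄ˣ) (ψ : Site d → Fin d → 𝕄) (x : Site d) : dhol V ψ x [] = 0 := rfl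

/-- `δ(l·Γ) = δl + Ad_{V(l)} δΓ`. [folklore] -/
@[simp] theorem dhol_cons (V : Site d → Fin d → 𝕄ˣ) (ψ : Site d → Fin d → 𝕄) (x : Site d) (l : Letter d)
    (w : List (Letter d)) :
    dhol V ψ x (l :: w) = dstep V ψ x l + Ad (stepHol V x l) (dhol V ψ (x + l.vec) w) := rfl

/-- The letter `+e_μ` contributes `Ad_{V(x,μ)} ψ(x,μ)`. [folklore] -/
theorem dstep_true (V : Site d → Fin d → 𝕄ˣ) (ψ : Site d → Fin d → 𝕄) (x : Site d) (μ : Fin d) :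
    dstep V ψ x (μ, true) = Ad (V x μ) (ψ x μ) := rfl

/-- The letter `−e_μ` contributes `−ψ(x − e_μ, μ)`. [folklore] -/
theorem dstep_false (V : Site d → Fin d → 𝕄ˣ) (ψ : Site d → Fin d → 𝕄) (x : Site d) (μ : Fin d) :
    dstep V ψ x (μ, false) = -ψ (x - e μ) μ := by
  simp [dstep, Letter.vec, sub_eq_add_neg]

/-- **Each letter's transport differentiates to `dstep · stepHol`** along `V e^{sψ}`. [folklore] -/
theorem hasDerivAt_val_stepHol_vary (V : Site d → Fin d → 𝕄ˣ) (ψ : Site d → Fin d → 𝕄) (x : Site d) (l : Letter d) :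
    HasDerivAt (fun s : ℝ => ((stepHol (vary V ψ s) x l : 𝕄ˣ) : 𝕄))
      (dstep V ψ x l * ((stepHol V x l : 𝕄ˣ) : 𝕄)) 0 := by
  obtain ⟨μ, b⟩ := l
  cases b
  · have h := (hasDerivAt_exp_neg_smul_zero (ψ (x + Letter.vec (μ, false)) μ)).mul_const
      ((((V (x + Letter.vec (μ, false)) μ)⁻¹ : 𝕄ˣ) : 𝕄))
    have e1 : (fun s : ℝ => ((stepHol (vary V ψ s) x (μ, false) : 𝕄ˣ) : 𝕄))
        = fun s : ℝ => exp (-((s : ℂ) • ψ (x + Letter.vec (μ, false)) μ))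
            * (((V (x + Letter.vec (μ, false)) μ)⁻¹ : 𝕄ˣ) : 𝕄) := by
      funext s
      simp only [stepHol, Bool.false_eq_true, ↓reduceIte, vary, mul_inv_rev, Units.val_mul, val_inv_expUnit,
        val_expUnit]
    rw [e1]
    refine h.congr_deriv ?_
    simp only [dstep, Bool.false_eq_true, ↓reduceIte, stepHol, neg_mul]
  · have h := (hasDerivAt_exp_smul_zero (ψ x μ)).const_mul ((V x μ : 𝕄ˣ) : 𝕄)
    have e1 : (fun s : ℝ => ((stepHol (vary V ψ s) x (μ, true) : 𝕄ˣ) : 𝕄))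
        = fun s : ℝ => ((V x μ : 𝕄ˣ) : 𝕄) * exp ((s : ℂ) • ψ x μ) := by
      funext s
      simp only [stepHol, ↓reduceIte, vary, Units.val_mul, val_expUnit]
    rw [e1]
    refine h.congr_deriv ?_
    simp only [dstep, ↓reduceIte, stepHol]
    rw [Ad_mul_val]

/-- **`d/ds|₀ V_s(Γ) = (δ_ψV)(Γ) · V(Γ)` FOR EVERY WORD `Γ`** (`V_s = V e^{sψ}`): the linearised parallel transport is the
left-trivialised derivative of (9) — the tree's `hasDerivAt_hol_vary` is the case of the plaquette word.
[cite: Balaban1985Averaging, (9) p.18, p.28] -/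
theorem hasDerivAt_val_hol_vary_word (V : Site d → Fin d → 𝕄ˣ) (ψ : Site d → Fin d → 𝕄) :
    ∀ (w : List (Letter d)) (x : Site d),
      HasDerivAt (fun s : ℝ => ((hol (vary V ψ s) x w : 𝕄ˣ) : 𝕄)) (dhol V ψ x w * ((hol V x w : 𝕄ˣ) : 𝕄)) 0
  | [], x => by
      simp only [hol_nil, Units.val_one, dhol_nil, zero_mul]
      exact hasDerivAt_const _ _
  | l :: w, x => by
      have h := (hasDerivAt_val_stepHol_vary V ψ x l).mul (hasDerivAt_val_hol_vary_word V ψ w (x + l.vec))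
      have e1 : (fun s : ℝ => ((hol (vary V ψ s) x (l :: w) : 𝕄ˣ) : 𝕄))
          = fun s : ℝ => ((stepHol (vary V ψ s) x l : 𝕄ˣ) : 𝕄) * ((hol (vary V ψ s) (x + l.vec) w : 𝕄ˣ) : 𝕄) := by
        funext s
        rw [hol_cons, Units.val_mul]
      rw [e1]
      refine h.congr_deriv ?_
      simp only [vary_zero, dhol_cons, hol_cons, Units.val_mul]
      unfold Ad
      simp only [add_mul, mul_assoc, Units.inv_mul_cancel_left]

/-- **Multiplicativity**: `δ(Γ₁Γ₂) = δΓ₁ + Ad_{V(Γ₁)} δΓ₂` (the second word read from the end-point of the first).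
[cite: Balaban1985Averaging, (56) p.27] -/
theorem dhol_append (V : Site d → Fin d → 𝕄ˣ) (ψ : Site d → Fin d → 𝕄) :
    ∀ (x : Site d) (w₁ w₂ : List (Letter d)),
      dhol V ψ x (w₁ ++ w₂) = dhol V ψ x w₁ + Ad (hol V x w₁) (dhol V ψ (x + disp w₁) w₂)
  | x, [], w₂ => by
      simp [disp, Ad_one']
  | x, l :: w₁, w₂ => by
      rw [List.cons_append, dhol_cons, dhol_cons, dhol_append V ψ (x + l.vec) w₁ w₂, hol_cons, Ad_mul, Ad_add', disp_cons]
      simp only [add_assoc]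

/-- **The plaquette word gives the tree's dressed curl**: `(δ_ψV)(∂p) = (d_Vψ)(p)` (both are the left-trivialised
derivative of `V_s(∂p)`; uniqueness of derivatives and cancellation of the unit `V(∂p)`). [cite: Balaban1985Averaging, (9) p.18, (44) p.24] -/
theorem dhol_plaqWord (V : Site d → Fin d → 𝕄ˣ) (ψ : Site d → Fin d → 𝕄) (z : Site d) (μ ν : Fin d) :
    dhol V ψ z (plaqWord μ ν) = curlAt V ψ z μ ν := by
  have h1 := hasDerivAt_val_hol_vary_word V ψ (plaqWord μ ν) z
  have h2 := T4AveragingDeficitWall.hasDerivAt_hol_vary V ψ z μ ν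
  have h := h1.unique h2
  exact Units.mul_left_inj _ |>.mp h

/-- The `ℓ¹` weight of a direction field along a word: `Σ_{b ⊂ Γ} |ψ(b)|` (each letter counted once). [folklore] -/
def lnorm (ψ : Site d → Fin d → 𝕄) : Site d → List (Letter d) → ℝ
  | _, [] => 0
  | x, l :: w => ‖ψ (if l.2 then x else x + l.vec) l.1‖ + lnorm ψ (x + l.vec) w

/-- `lnorm` of the empty word. [folklore] -/
@[simp] theorem lnorm_nil (ψ : Site d → Fin d → 𝕄) (x : Site d) : lnorm ψ x [] = 0 := rfl

/-- `lnorm` of a cons. [folklore] -/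
@[simp] theorem lnorm_cons (ψ : Site d → Fin d → 𝕄) (x : Site d) (l : Letter d) (w : List (Letter d)) :
    lnorm ψ x (l :: w) = ‖ψ (if l.2 then x else x + l.vec) l.1‖ + lnorm ψ (x + l.vec) w := rfl

/-- The norm of one letter's contribution on `U(N)` data: `|dstep| ≤ |ψ(b)|`. [folklore] -/
theorem norm_dstep_le {V : Site d → Fin d → 𝕄ˣ} (hV : IsUnitaryCfg V) (ψ : Site d → Fin d → 𝕄) (x : Site d)
    (l : Letter d) : ‖dstep V ψ x l‖ ≤ ‖ψ (if l.2 then x else x + l.vec) l.1‖ := by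
  obtain ⟨μ, b⟩ := l
  cases b
  · simp [dstep]
  · simp only [dstep, ↓reduceIte]
    exact (norm_Ad_of_unitary (hV x μ) _).le

/-- **`|(δ_ψV)(Γ)| ≤ Σ_{b ⊂ Γ} |ψ(b)|` on `U(N)`-valued configurations** (`Ad` is isometric for the operator norm (19)).
[cite: Balaban1985Averaging, (19) p.21, (56) p.27] -/
theorem norm_dhol_le {V : Site d → Fin d → 𝕄ˣ} (hV : IsUnitaryCfg V) (ψ : Site d → Fin d → 𝕄) :
    ∀ (x : Site d) (w : List (Letter d)), ‖dhol V ψ x w‖ ≤ lnorm ψ x w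
  | x, [] => by simp
  | x, l :: w => by
      rw [dhol_cons, lnorm_cons]
      have hstep : stepHol V x l ∈ unitaryUnits 𝕄 := by
        obtain ⟨μ, b⟩ := l
        cases b
        · exact (unitaryUnits 𝕄).inv_mem (hV _ μ)
        · exact hV x μ
      refine (norm_add_le _ _).trans (add_le_add (norm_dstep_le hV ψ x l) ?_)
      rw [norm_Ad_of_unitary hstep]
      exact norm_dhol_le hV ψ _ w


/-! ## §2 Skew-adjointness: `δ_ψV`, the dressed curl and their `Re tr` on `U(N)` data with `𝔲(N)` directions -/

/-- For a unitary unit `u`, `u⁻¹ = u⋆`. [folklore] -/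
theorem val_inv_eq_star_of_unitary {u : 𝕄ˣ} (hu : u ∈ unitaryUnits 𝕄) :
    ((u⁻¹ : 𝕄ˣ) : 𝕄) = star (u : 𝕄) :=
  Units.inv_eq_of_mul_eq_one_left (Unitary.star_mul_self_of_mem (mem_unitaryUnits.mp hu))

/-- `U(N) ⊂ {|u| ≤ 1, |u⁻¹| ≤ 1}` (operator norm (19)). [folklore] -/
theorem mem_U1_of_unitary [Nonempty n] {u : 𝕄ˣ} (hu : u ∈ unitaryUnits 𝕄) : u ∈ U1 𝕄 :=
  ⟨(CStarRing.norm_of_mem_unitary (mem_unitaryUnits.mp hu)).le,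
    (CStarRing.norm_of_mem_unitary (mem_unitaryUnits.mp ((unitaryUnits 𝕄).inv_mem hu))).le⟩

/-- `Ad_u` preserves skew-adjointness for unitary `u`. [folklore] -/
theorem Ad_mem_skewAdjoint {u : 𝕄ˣ} (hu : u ∈ unitaryUnits 𝕄) {X : 𝕄} (hX : X ∈ skewAdjoint 𝕄) :
    Ad u X ∈ skewAdjoint 𝕄 := by
  rw [skewAdjoint.mem_iff] at hX ⊢
  unfold Ad
  rw [val_inv_eq_star_of_unitary hu, star_mul, star_mul, star_star, hX, ← mul_assoc, mul_neg, neg_mul]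

/-- Each letter's contribution is skew for skew `ψ` and unitary `V`. [folklore] -/
theorem dstep_mem_skewAdjoint {V : Site d → Fin d → 𝕄ˣ} (hV : IsUnitaryCfg V) {ψ : Site d → Fin d → 𝕄}
    (hψ : IsSkewDir ψ) (x : Site d) (l : Letter d) : dstep V ψ x l ∈ skewAdjoint 𝕄 := by
  obtain ⟨μ, b⟩ := l
  cases b
  · simp only [dstep, Bool.false_eq_true, ↓reduceIte]
    exact (skewAdjoint 𝕄).neg_mem (hψ _ _)
  · exact Ad_mem_skewAdjoint (hV x μ) (hψ x μ)

/-- **`(δ_ψV)(Γ)` is skew-adjoint** for `𝔲(N)`-valued `ψ` on `U(N)`-valued `V`. [folklore] -/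
theorem dhol_mem_skewAdjoint {V : Site d → Fin d → 𝕄ˣ} (hV : IsUnitaryCfg V) {ψ : Site d → Fin d → 𝕄}
    (hψ : IsSkewDir ψ) : ∀ (x : Site d) (w : List (Letter d)), dhol V ψ x w ∈ skewAdjoint 𝕄
  | x, [] => by simp
  | x, l :: w => by
    rw [dhol_cons]
    have hstep : stepHol V x l ∈ unitaryUnits 𝕄 := by
      obtain ⟨μ, b⟩ := l
      cases b
      · exact (unitaryUnits 𝕄).inv_mem (hV _ μ)
      · exact hV x μ
    exact (skewAdjoint 𝕄).add_mem (dstep_mem_skewAdjoint hV hψ x l)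
      (Ad_mem_skewAdjoint hstep (dhol_mem_skewAdjoint hV hψ _ w))

/-- **The dressed curl `(d_Vψ)(p)` is skew-adjoint** for `𝔲(N)`-valued `ψ` on `U(N)`-valued `V`. [folklore] -/
theorem curl_mem_skewAdjoint {V : Site d → Fin d → 𝕄ˣ} (hV : IsUnitaryCfg V) {ψ : Site d → Fin d → 𝕄}
    (hψ : IsSkewDir ψ) (p : T4AveragingDeficitWall.Plaq d) : curl V ψ p ∈ skewAdjoint 𝕄 := by
  rw [curl, ← dhol_plaqWord]
  exact dhol_mem_skewAdjoint hV hψ _ _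

omit [DecidableEq n] in
/-- `Re tr X = 0` for skew-adjoint `X` (B12 (0.2)'s normalised trace). [folklore] -/
theorem nReTr_eq_zero_of_mem_skewAdjoint {X : 𝕄} (hX : X ∈ skewAdjoint 𝕄) : nReTr X = 0 := by
  rw [skewAdjoint.mem_iff, Matrix.star_eq_conjTranspose] at hX
  have h1 : (Xᴴ).trace = star X.trace := Matrix.trace_conjTranspose X
  rw [hX, Matrix.trace_neg] at h1
  have h2 : X.trace.re = 0 := by
    have := congrArg Complex.re h1
    simp only [Complex.neg_re, Complex.star_def, Complex.conj_re] at this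
    linarith
  simp [nReTr, h2]

/-- **THE LOG-DERIVATIVE OF A UNITARY PATH IS SKEW**: if `f` is unitary near `0` with derivative `f′` at `0`, then
`f′ · f(0)⋆ = f′ f(0)⁻¹` is skew-adjoint (differentiate `f f⋆ = 1`). [folklore] -/
theorem mem_skewAdjoint_of_unitary_path {f : ℝ → 𝕄} {f' : 𝕄} (hf : HasDerivAt f f' 0)
    (hu : ∀ᶠ s in 𝓝 (0 : ℝ), f s ∈ unitary 𝕄) : f' * star (f 0) ∈ skewAdjoint 𝕄 := by
  have h0 : f 0 ∈ unitary 𝕄 := hu.self_of_nhds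
  have hg : HasDerivAt (fun s => f s * star (f s)) (f' * star (f 0) + f 0 * star f') 0 := hf.mul hf.star
  have hc : HasDerivAt (fun s => f s * star (f s)) 0 0 := by
    refine (hasDerivAt_const (0 : ℝ) (1 : 𝕄)).congr_of_eventuallyEq ?_
    exact hu.mono fun s hs => Unitary.mul_star_self_of_mem hs
  have hsum : f' * star (f 0) + f 0 * star f' = 0 := hg.unique hc
  rw [skewAdjoint.mem_iff, star_mul, star_star]
  exact (eq_neg_of_add_eq_zero_right hsum)

end

end Summit.QuantumFields.BalabanUV.T4Continuum.AveragingDeficitTransport
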